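import Summits.QuantumFields.BalabanUV.Beta.GAN24.DressingDefectOfDivergences
import Summits.QuantumFields.BalabanUV.Beta.GAN24.T2ShapeEvenEnd
import Summits.QuantumFields.BalabanUV.Beta.GAN24.Lin4ZeroMode
import Summits.QuantumFields.BalabanUV.Beta.GAN24.T2RecChargeStep
import Summits.QuantumFields.BalabanUV.Beta.GAN24.SlotDivergenceLetters

/-!
# `BalabanUV.Beta.GAN24.HalfMemberCellOfDivergences` — binder row G-an2-4 ∕ (CONV-C), W-slot, the (α-0) parity re-cut's (α-END-b) ASSEMBLY STEP, FILE 2 of the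
# journal INTENT [LEAF03-G66-ONLINE] «DIVERGENCE LETTERS ⇒ CELL»: **THE `hcell` ROW OF THE OWNER gan24-p1 g33's END `T2ShapeEvenEndRows.locStencil₂_halfMember_three_of_rows`
# — the cells `𝒜^Ĝ_l y_l − 𝒜^K_l y_l` of the `ε`-member UNIFORMLY `LocStencil₂` — FROM FOUR SINGLE-DIVERGENCE LETTER ROWS ON `y_l` WITH LEVEL-FREE CONSTANTS**
# (two source-slot rows = what (b1) ∘ F4 ∘ the S-slot rows deliver; two kernel-leg rows = what (Q-L), row L11, delivers).

NOT IN PRINT; OUR BOOKKEEPING (G-an2-4 crux team (2), leaf prover `b2b-balaban-gan24-formalise-leaf-03`, gen 66).  [folklore] composition BY NAME: leaf-06 g43's one-level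
difference `TableDressingDefect.lin4_comb_coDressKBmAt_sub` (`𝒜^Ĝ_l X − 𝒜^K_l X = 𝒜^K_l (𝔇 X − X)`), FILE 1 `DressingDefectOfDivergences.locStencil₂_tableDress_sub_self_of_divergences`
(`𝔇 X − X` is `LocStencil₂` by the four letters, constant a function of `(d, Lc, δ)` alone), leaf-18's one undressed step `Lin4ZeroMode.locStencil₂_lin4`; at `d = 3` road P1's
K-slot `KSlotAssembly.convCKWall_holds` and the member's shape (`T2RecChargeStep.shape_member` ⨾ the OWNER's `T2ShapeEvenEnd.locStencil₂_halfTable`) BY NAME.  0 `def`, 0 cited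
facts, 0 `def … : Prop`, 0 sorry.
HONEST FRAMING (cell contract, verbatim): «discharging `BetaPertH` makes Bałaban's UV stability UNCONDITIONAL — a real constructive-QFT result; it is NOT the continuum
limit and NOT the Clay problem.»  HONEST DEPENDENCY (verbatim): «continuum YM on T⁴ ⇐ BetaPertH ∧ nine spine estimates (0/9 proved); BetaPertH ⇐ (D1) ∧ (D4) ∧ CAP+tail;
G-an2-4 gates asym, D1 and NE2/3/4.»

## What
* §0 DOCKING — THE FOUR ROWS OF A PLAIN `LocStencil₂` TABLE BY ITS OWN CONSTANT (`letterRow_snd ∕ fst ∕ leg₁ ∕ leg₂_of_locStencil₂`: constants `(d+1)(e^{δ}+1)·C`,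
  `(d+1)(e^{3δ}+1)·C`, `(d+1)(e^{δ}+1)·C`, `(d+1)(e^{δ}+1)·C`; the two slot rows are leaf-02's `SlotDivergenceLetters` §2 in row form) — for member `0` of the tower (its own
  constant IS level-free) and as the consistency twin of leaf-06's `locStencil₂_tableDress_sub_self` (the table's own constant — the accumulation (B4) prices — is what the
  `l ≥ 1` members must NOT use).
* §1 (generic `d`, `Lc ≥ 1`, in-block root, ANY family `Z : ℕ → Tab d`, any `c`): **`cell_rows_of_divergence_rows`** — under uniformly decaying unit step kernels
  (`hK : ∀ j, Decays (unitK_j (KInvStep Lc j)) CK δK`, DISPLAYED) and the four letter rows of FILE 1 on every `Z_l` with `l`-FREE constants `C₂ C₁ C_{L1} C_{L2}` at one rate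
  `δ > 0` (plus the mere existence of SOME `LocStencil₂` shape of each `Z_l`, for summability):
  `∀ l, LocStencil₂ (𝒜^Ĝ_l Z_l − 𝒜^K_l Z_l) Ccl (min δK δ ∕ 128)` with ONE explicit `Ccl` (leaf-18's `lin4` constant at the FILE 1 defect constant).
* §2 (`d = 3`, `2 ≤ Lc`, in-block root, any pins `cE cVH cΛ cE₂ cB Tc`, any `LocStencil₂` border `vh₂S`, `|ε| ≤ 1`): **`hcell_of_divergence_rows`** — THE `hcell` ROW OF
  `T2ShapeEvenEndRows` VERBATIM (`∃ Ccl δcl, 0 < δcl ∧ ∀ l, LocStencil₂ (𝒜^Ĝ_l y_l − 𝒜^K_l y_l) Ccl δcl`, `y_l := ½ • (T♮̃_l + ε • P T♮̃_l)` in the END's EXACT spelling) from the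
  four letter rows on `y_l`, `∀ l`, ONE constant each; K-slot and member shapes BY NAME.
WHAT STAYS DISPLAYED after FILE 2 in the (α-0) END (with the OWNER's PART 2): the S-slot rows `(hS, hSall)`, the border rows, `hC` ((C) at the relative source) and, in place of
`hcell`, the four letter rows on `y_l` — the two SLOT rows ⟸ (b1) `HalfMemberSlavedDivergence(Comb)` (leaf-01 g72) ∘ `SlotDivergenceLetters.letter_fst_of_locStencil₂` (F4) ∘ ONE
S-slot letter row on `e3OfK Lc K♮ᴱ_l [(sf·sm)⁻¹ • unitS (cH′⁻¹ • [S_l, X_p])]` (leaf-01 g72 W-2's located row (ii)); the two LEG rows = (Q-L) in letter currency ((H1)^{⊥} display,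
RULING R-gan24p1-g33-2 (3)).  Asserts NO value of any divergence of Bałaban's tables; discharges NOTHING of (Q-L) ∕ (Q-S) ∕ (C) ∕ «T2Shape» ∕ «T2Drift» ∕ (hW, hWall); (β) of
record untouched; 0 wall binders; NEVER «G-an2-4 closed» as (CONV-C); NOT D1, NOT `BetaPertH`, NOT continuum, NOT Clay; not in print — our bookkeeping.
Unit `b2b-balaban-gan24-formalise-leaf-03` (gen 66), 2026-08-23.
-/

noncomputable section

open Finset
open scoped BigOperators
open Literature.MathematicalPhysics.QuantumFieldTheory
open Literature.MathematicalPhysics.QuantumFieldTheory.Balaban1983to89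
open Literature.MathematicalPhysics.QuantumFieldTheory.Balaban1983to89.Beta
open ExpKernelCalculus (MKer shiftK BiLoc Decays Zl)
open OneStepResolventKernel (Fib LocStencil)
open OneStepKernelFamily (KInvStep)
open AffineAveraging (box toSite unitVec)
open AveragingMixedJetTables (mixFFAt)
open SecondOrderResponse (W2SymOfK cBi)
open KernelWard (divV)
open BalabanCompositeJets (LocStencil₂)
open BalabanStepJetsSucc (mmRead)
open BalabanStepW2 (K3OfK M2Of)
open Summit.QuantumFields.BalabanUV.Beta.TameKernelCalculus (trK)
open Summit.QuantumFields.BalabanUV.Beta.BorderedHessian (sgnK)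
open Summit.QuantumFields.BalabanUV.Beta.HessKerDressedUnits (unitK unitS)
open Summit.QuantumFields.BalabanUV.Beta.SecondOrderUnits (unitM unitS₂ unitM₂)
open Summit.QuantumFields.BalabanUV.Beta.AxialDressingRooted (cWb cKb coDressKBmAt coProjBmAtK dressKBmAt one_le_of_neZero)
open Summit.QuantumFields.BalabanUV.Beta.SpineRooted (T2RecAt SpureRecAt M1At)
open Summit.QuantumFields.BalabanUV.Beta.GAN24.CombesThomas (sfStep smStep)
open Summit.QuantumFields.BalabanUV.Beta.GAN24.T2RecursionAffine (lin4)
open Summit.QuantumFields.BalabanUV.Beta.GAN24.BiStencilZeroMode (Tab)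
open Summit.QuantumFields.BalabanUV.Beta.GAN24.KSlotAssembly (convCKWall_holds)
open Summit.QuantumFields.BalabanUV.Beta.GAN24.Lin4ZeroMode (locStencil₂_lin4)
open Summit.QuantumFields.BalabanUV.Beta.GAN24.TableDressingDefect (lin4_comb_coDressKBmAt_sub)
open Summit.QuantumFields.BalabanUV.Beta.GAN24.T2RecChargeStep (shape_member)
open Summit.QuantumFields.BalabanUV.Beta.GAN24.T2ShapeEvenEnd (locStencil₂_halfTable)
open Summit.QuantumFields.BalabanUV.Beta.GAN24.DressingDefectOfDivergences (locStencil₂_tableDress_sub_self_of_divergences)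
open Summit.QuantumFields.BalabanUV.Beta.GAN24.SlotDivergenceLetters (exp_shift_unit_le' letter_fst_of_locStencil₂ letter_snd_of_locStencil₂)
open B12Sec2to5 (l1)

namespace Summit.QuantumFields.BalabanUV.Beta.GAN24.HalfMemberCellOfDivergences

/-! ## §0 Docking: the four rows of a plain `LocStencil₂` table, by its own constant -/

section Docking

variable {d : ℕ}

/-- [folklore] **THE SECOND-SLOT ROW OF A `LocStencil₂` TABLE** (leaf-02's `letter_snd_of_locStencil₂` in row form; constant `(d+1)(e^{δ}+1)·C`). -/
theorem letterRow_snd_of_locStencil₂ {Y : Tab d} {C δ : ℝ} (hY : LocStencil₂ Y C δ) (hδ : 0 ≤ δ) :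
    LocStencil₂ (fun (κ : Fin (d + 1)) (u : Fin (d + 1) → ℤ) (_ : Fin (d + 1)) (p : Fin (d + 1) → ℤ) =>
      divV (fun κ₁ u₁ => Y κ u κ₁ u₁) p) (((d : ℝ) + 1) * (Real.exp δ + 1) * C) δ :=
  fun κ u _ p x z a b => letter_snd_of_locStencil₂ hY hδ κ u p x z a b

/-- [folklore] **THE FIRST-SLOT ROW OF A `LocStencil₂` TABLE** (leaf-02's `letter_fst_of_locStencil₂` in row form; constant `(d+1)(e^{3δ}+1)·C`). -/
theorem letterRow_fst_of_locStencil₂ {Y : Tab d} {C δ : ℝ} (hY : LocStencil₂ Y C δ) (hδ : 0 ≤ δ) :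
    LocStencil₂ (fun (_ : Fin (d + 1)) (p : Fin (d + 1) → ℤ) (κ' : Fin (d + 1)) (u' : Fin (d + 1) → ℤ) =>
      divV (fun κ₁ u₁ => Y κ₁ u₁ κ' u') p) (((d : ℝ) + 1) * (Real.exp (3 * δ) + 1) * C) δ :=
  fun _ p κ' u' x z a b => letter_fst_of_locStencil₂ hY hδ p κ' u' x z a b

/-- [folklore] **THE FIRST-LEG ROW OF A `LocStencil₂` TABLE** (one unit step in the first kernel leg costs `e^{δ}`; constant `(d+1)(e^{δ}+1)·C`). -/
theorem letterRow_leg₁_of_locStencil₂ {Y : Tab d} {C δ : ℝ} (hY : LocStencil₂ Y C δ) (hδ : 0 ≤ δ) :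
    LocStencil₂ (fun κ u κ' u' => fun (p z : Fin (d + 1) → ℤ) (_ : Fib d) (b : Fib d) =>
      ∑ β : Fin (d + 1), (Y κ u κ' u' p z (Sum.inl β) b - Y κ u κ' u' (p - unitVec β) z (Sum.inl β) b)) (((d : ℝ) + 1) * (Real.exp δ + 1) * C) δ := by
  have hC : 0 ≤ C := hY.nonneg
  intro κ u κ' u' p z a b
  set E : ℝ := C * Real.exp (-δ * l1 (u' - u)) with hE
  have hE0 : 0 ≤ E := mul_nonneg hC (Real.exp_pos _).le
  have hterm : ∀ β : Fin (d + 1), |Y κ u κ' u' p z (Sum.inl β) b - Y κ u κ' u' (p - unitVec β) z (Sum.inl β) b|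
      ≤ (Real.exp δ + 1) * E * Real.exp (-δ * (l1 (p - u) + l1 (z - u))) := by
    intro β
    have h1 : |Y κ u κ' u' p z (Sum.inl β) b| ≤ E * Real.exp (-δ * (l1 (p - u) + l1 (z - u))) := hY κ u κ' u' p z (Sum.inl β) b
    have h2 : |Y κ u κ' u' (p - unitVec β) z (Sum.inl β) b| ≤ E * Real.exp (-δ * (l1 ((p - unitVec β) - u) + l1 (z - u))) :=
      hY κ u κ' u' (p - unitVec β) z (Sum.inl β) b
    have hs : Real.exp (-δ * (l1 ((p - unitVec β) - u) + l1 (z - u))) ≤ Real.exp δ * Real.exp (-δ * (l1 (p - u) + l1 (z - u))) := by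
      have h := exp_shift_unit_le' hδ p u β
      have e1 : Real.exp (-δ * (l1 ((p - unitVec β) - u) + l1 (z - u))) = Real.exp (-δ * l1 ((p - unitVec β) - u)) * Real.exp (-δ * l1 (z - u)) := by
        rw [← Real.exp_add]; ring_nf
      have e2 : Real.exp (-δ * (l1 (p - u) + l1 (z - u))) = Real.exp (-δ * l1 (p - u)) * Real.exp (-δ * l1 (z - u)) := by
        rw [← Real.exp_add]; ring_nf
      rw [e1, e2, ← mul_assoc]
      exact mul_le_mul_of_nonneg_right h (Real.exp_pos _).le
    calc |Y κ u κ' u' p z (Sum.inl β) b - Y κ u κ' u' (p - unitVec β) z (Sum.inl β) b|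
        ≤ |Y κ u κ' u' p z (Sum.inl β) b| + |Y κ u κ' u' (p - unitVec β) z (Sum.inl β) b| := abs_sub _ _
      _ ≤ E * Real.exp (-δ * (l1 (p - u) + l1 (z - u))) + E * (Real.exp δ * Real.exp (-δ * (l1 (p - u) + l1 (z - u)))) :=
          add_le_add h1 (h2.trans (mul_le_mul_of_nonneg_left hs hE0))
      _ = (Real.exp δ + 1) * E * Real.exp (-δ * (l1 (p - u) + l1 (z - u))) := by ring
  calc |∑ β : Fin (d + 1), (Y κ u κ' u' p z (Sum.inl β) b - Y κ u κ' u' (p - unitVec β) z (Sum.inl β) b)|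
      ≤ ∑ β : Fin (d + 1), |Y κ u κ' u' p z (Sum.inl β) b - Y κ u κ' u' (p - unitVec β) z (Sum.inl β) b| := Finset.abs_sum_le_sum_abs _ _
    _ ≤ ∑ _β : Fin (d + 1), (Real.exp δ + 1) * E * Real.exp (-δ * (l1 (p - u) + l1 (z - u))) := Finset.sum_le_sum fun β _ => hterm β
    _ = ((d : ℝ) + 1) * (Real.exp δ + 1) * C * Real.exp (-δ * l1 (u' - u)) * Real.exp (-δ * (l1 (p - u) + l1 (z - u))) := by
        rw [Finset.sum_const, Finset.card_univ, Fintype.card_fin, nsmul_eq_mul, hE]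
        push_cast
        ring

/-- [folklore] **THE SECOND-LEG ROW OF A `LocStencil₂` TABLE** (one unit step in the second kernel leg costs `e^{δ}`; constant `(d+1)(e^{δ}+1)·C`). -/
theorem letterRow_leg₂_of_locStencil₂ {Y : Tab d} {C δ : ℝ} (hY : LocStencil₂ Y C δ) (hδ : 0 ≤ δ) :
    LocStencil₂ (fun κ u κ' u' => fun (x p : Fin (d + 1) → ℤ) (a : Fib d) (_ : Fib d) =>
      ∑ β : Fin (d + 1), (Y κ u κ' u' x p a (Sum.inl β) - Y κ u κ' u' x (p - unitVec β) a (Sum.inl β))) (((d : ℝ) + 1) * (Real.exp δ + 1) * C) δ := by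
  have hC : 0 ≤ C := hY.nonneg
  intro κ u κ' u' x p a b
  set E : ℝ := C * Real.exp (-δ * l1 (u' - u)) with hE
  have hE0 : 0 ≤ E := mul_nonneg hC (Real.exp_pos _).le
  have hterm : ∀ β : Fin (d + 1), |Y κ u κ' u' x p a (Sum.inl β) - Y κ u κ' u' x (p - unitVec β) a (Sum.inl β)|
      ≤ (Real.exp δ + 1) * E * Real.exp (-δ * (l1 (x - u) + l1 (p - u))) := by
    intro β
    have h1 : |Y κ u κ' u' x p a (Sum.inl β)| ≤ E * Real.exp (-δ * (l1 (x - u) + l1 (p - u))) := hY κ u κ' u' x p a (Sum.inl β)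
    have h2 : |Y κ u κ' u' x (p - unitVec β) a (Sum.inl β)| ≤ E * Real.exp (-δ * (l1 (x - u) + l1 ((p - unitVec β) - u))) :=
      hY κ u κ' u' x (p - unitVec β) a (Sum.inl β)
    have hs : Real.exp (-δ * (l1 (x - u) + l1 ((p - unitVec β) - u))) ≤ Real.exp δ * Real.exp (-δ * (l1 (x - u) + l1 (p - u))) := by
      have h := exp_shift_unit_le' hδ p u β
      have e1 : Real.exp (-δ * (l1 (x - u) + l1 ((p - unitVec β) - u))) = Real.exp (-δ * l1 (x - u)) * Real.exp (-δ * l1 ((p - unitVec β) - u)) := by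
        rw [← Real.exp_add]; ring_nf
      have e2 : Real.exp (-δ * (l1 (x - u) + l1 (p - u))) = Real.exp (-δ * l1 (x - u)) * Real.exp (-δ * l1 (p - u)) := by
        rw [← Real.exp_add]; ring_nf
      rw [e1, e2, mul_left_comm]
      exact mul_le_mul_of_nonneg_left h (Real.exp_pos _).le
    calc |Y κ u κ' u' x p a (Sum.inl β) - Y κ u κ' u' x (p - unitVec β) a (Sum.inl β)|
        ≤ |Y κ u κ' u' x p a (Sum.inl β)| + |Y κ u κ' u' x (p - unitVec β) a (Sum.inl β)| := abs_sub _ _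
      _ ≤ E * Real.exp (-δ * (l1 (x - u) + l1 (p - u))) + E * (Real.exp δ * Real.exp (-δ * (l1 (x - u) + l1 (p - u)))) :=
          add_le_add h1 (h2.trans (mul_le_mul_of_nonneg_left hs hE0))
      _ = (Real.exp δ + 1) * E * Real.exp (-δ * (l1 (x - u) + l1 (p - u))) := by ring
  calc |∑ β : Fin (d + 1), (Y κ u κ' u' x p a (Sum.inl β) - Y κ u κ' u' x (p - unitVec β) a (Sum.inl β))|
      ≤ ∑ β : Fin (d + 1), |Y κ u κ' u' x p a (Sum.inl β) - Y κ u κ' u' x (p - unitVec β) a (Sum.inl β)| := Finset.abs_sum_le_sum_abs _ _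
    _ ≤ ∑ _β : Fin (d + 1), (Real.exp δ + 1) * E * Real.exp (-δ * (l1 (x - u) + l1 (p - u))) := Finset.sum_le_sum fun β _ => hterm β
    _ = ((d : ℝ) + 1) * (Real.exp δ + 1) * C * Real.exp (-δ * l1 (u' - u)) * Real.exp (-δ * (l1 (x - u) + l1 (p - u))) := by
        rw [Finset.sum_const, Finset.card_univ, Fintype.card_fin, nsmul_eq_mul, hE]
        push_cast
        ring

end Docking

/-! ## §1 Generic `d`: the cells of any family from its four letter rows and a uniformly decaying unit step kernel -/

section Generic

variable {d : ℕ} {Lc : ℕ} [NeZero Lc] {r : Fin (d + 1) → ℕ}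

/-- NOT IN PRINT; OUR BOOKKEEPING.  **THE CELLS OF A FAMILY FROM ITS FOUR LETTER ROWS** (generic `d`, in-block root, any `c`; uniformly decaying unit step kernels
DISPLAYED as `hK`): if every `Z_l` has SOME `LocStencil₂` shape (existence only) and carries the four single-divergence letter rows of FILE 1 with `l`-FREE constants
`C₂ C₁ C_{L1} C_{L2}` at one rate `δ > 0`, then every cell `𝒜^Ĝ_l Z_l − 𝒜^K_l Z_l` (`𝒜^Ĝ_l = lin4 c (unitK_l (coDressKBmAt ρ Lc (KInvStep Lc l))) Lc`,
`𝒜^K_l = lin4 c (unitK_l (KInvStep Lc l)) Lc`) is `LocStencil₂` with ONE constant at rate `min δK δ ∕ 128` — leaf-06's `lin4_comb_coDressKBmAt_sub` ⨾ FILE 1 ⨾ leaf-18's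
`locStencil₂_lin4`.  The rows are HYPOTHESES. -/
theorem cell_rows_of_divergence_rows (hr : r ∈ box (d + 1) Lc) (c : ℝ) (Z : ℕ → Tab d) {CK δK : ℝ}
    (hK : ∀ j : ℕ, Decays (unitK (sfStep Lc j) (smStep d Lc j) (KInvStep (d := d) Lc j)) CK δK) (hδK : 0 < δK)
    {C₂ C₁ CL₁ CL₂ δ : ℝ} (hδ : 0 < δ)
    (hZ : ∀ l, ∃ CZ δZ : ℝ, 0 < δZ ∧ LocStencil₂ (Z l) CZ δZ)
    (h₂ : ∀ l, LocStencil₂ (fun (κ : Fin (d + 1)) (u : Fin (d + 1) → ℤ) (_ : Fin (d + 1)) (p : Fin (d + 1) → ℤ) =>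
      divV (fun κ₁ u₁ => Z l κ u κ₁ u₁) p) C₂ δ)
    (h₁ : ∀ l, LocStencil₂ (fun (_ : Fin (d + 1)) (p : Fin (d + 1) → ℤ) (κ' : Fin (d + 1)) (u' : Fin (d + 1) → ℤ) =>
      divV (fun κ₁ u₁ => Z l κ₁ u₁ κ' u') p) C₁ δ)
    (hL₁ : ∀ l, LocStencil₂ (fun κ u κ' u' => fun (p z : Fin (d + 1) → ℤ) (_ : Fib d) (b : Fib d) =>
      ∑ β : Fin (d + 1), (Z l κ u κ' u' p z (Sum.inl β) b - Z l κ u κ' u' (p - unitVec β) z (Sum.inl β) b)) CL₁ δ)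
    (hL₂ : ∀ l, LocStencil₂ (fun κ u κ' u' => fun (x p : Fin (d + 1) → ℤ) (a : Fib d) (_ : Fib d) =>
      ∑ β : Fin (d + 1), (Z l κ u κ' u' x p a (Sum.inl β) - Z l κ u κ' u' x (p - unitVec β) a (Sum.inl β))) CL₂ δ) :
    ∀ l, LocStencil₂
      (lin4 c (unitK (sfStep Lc l) (smStep d Lc l) (coDressKBmAt (toSite r) Lc (KInvStep (d := d) Lc l))) Lc (Z l)
        - lin4 c (unitK (sfStep Lc l) (smStep d Lc l) (KInvStep (d := d) Lc l)) Lc (Z l))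
      (|c| * ((Fintype.card (Fib d) : ℝ) * ((Fintype.card (Fib d) : ℝ) * (CK * cBi d CK 1 (min δK δ)) * Zl (d + 1) (min δK δ / 32 / 2) * CK) *
          Zl (d + 1) (min δK δ / 32 / 4) *
        (2 * ((d : ℝ) + 1) * Lc * ((((2 * Lc + 1) ^ (d + 1) : ℕ) : ℝ) * (Real.exp (δ * (((d : ℝ) + 1) * Lc)) * C₂))
          + 2 * ((d : ℝ) + 1) * Lc * ((((2 * Lc + 1) ^ (d + 1) : ℕ) : ℝ) * (Real.exp (3 * δ * (((d : ℝ) + 1) * Lc)) * (cKb d Lc δ * C₁)))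
          + 2 * ((d : ℝ) + 1) * Lc * ((((2 * Lc + 1) ^ (d + 1) : ℕ) : ℝ)
              * (Real.exp (δ * (((d : ℝ) + 1) * Lc)) * (cWb d Lc * Real.exp (3 * δ * (((d : ℝ) + 1) * Lc)) * (cKb d Lc δ * CL₁))))
          + 2 * ((d : ℝ) + 1) * Lc * ((((2 * Lc + 1) ^ (d + 1) : ℕ) : ℝ)
              * (Real.exp (δ * (((d : ℝ) + 1) * Lc)) * (cKb d Lc δ * (cWb d Lc * Real.exp (3 * δ * (((d : ℝ) + 1) * Lc)) * (cKb d Lc δ * CL₂))))))))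
      (min δK δ / 128) := by
  have hLc : 1 ≤ Lc := one_le_of_neZero Lc
  have hCK : 0 ≤ CK := (hK 0).nonneg (Sum.inl 0)
  intro l
  obtain ⟨CZ, δZ, hδZ, hZl⟩ := hZ l
  rw [lin4_comb_coDressKBmAt_sub hr l hZl hδZ c]
  exact locStencil₂_lin4 (hK l) hCK hδK hLc c
    (locStencil₂_tableDress_sub_self_of_divergences hLc hr (Z l) hδ.le (h₂ l) (h₁ l) (hL₁ l) (hL₂ l)) hδ

end Generic

/-! ## §2 `d = 3`: the `hcell` row of `T2ShapeEvenEndRows` from the four letter rows on the `ε`-member -/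

section Three

variable {Lc : ℕ} [NeZero Lc] {r : Fin (3 + 1) → ℕ}

/-- NOT IN PRINT; OUR BOOKKEEPING.  **THE `hcell` ROW OF THE (α-0) END FROM FOUR LETTER ROWS ON THE `ε`-MEMBER** (`d = 3`, `2 ≤ Lc`, in-block root `r`, any pins
`cE cVH cΛ cE₂ cB Tc`, any `LocStencil₂` border `vh₂S` of positive rate, `|ε| ≤ 1`): write `y_l := ½ • (T♮̃_l + ε • P T♮̃_l)`,
`T♮̃_l := unitS₂_l (T2RecAt 3 Lc ρ cE cVH cΛ cE₂ cB Tc vh₂S (mixFFAt ρ Lc) l)`, `P T κ u κ′ u′ := sgnK (trK (T κ u κ′ u′))` (the END's EXACT spelling).  If, for every `l`, the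
second-source-slot, first-source-slot, first-kernel-leg and second-kernel-leg divergences of `y_l` carry the four letter rows with `l`-FREE constants `C₂ C₁ C_{L1} C_{L2}` at one
rate `δ > 0`, then `∃ Ccl δcl, 0 < δcl ∧ ∀ l, LocStencil₂ (𝒜^Ĝ_l y_l − 𝒜^K_l y_l) Ccl δcl` — VERBATIM the `hcell` binder of the OWNER gan24-p1 g33's
`T2ShapeEvenEndRows.locStencil₂_halfMember_three_of_rows` (`c₄ = cE₂·Lc^{2(3+1)}`).  §1 with road P1's K-slot (`convCKWall_holds`) and the member's shape (`shape_member` ⨾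
`locStencil₂_halfTable`) BY NAME.  The four rows are HYPOTHESES: the slot rows are (b1) ∘ F4 ∘ one S-slot letter, the leg rows are (Q-L); nothing of them is proved here. -/
theorem hcell_of_divergence_rows (hLc : 2 ≤ Lc) (hr : r ∈ box (3 + 1) Lc) (cE cVH cΛ cE₂ cB : ℝ) (Tc : Fin 4 → Fin 4 → Fin 4 → Fin 4 → ℝ)
    {vh₂S : Fin (3 + 1) → (Fin (3 + 1) → ℤ) → Fin (3 + 1) → (Fin (3 + 1) → ℤ) → MKer (3 + 1) (Fib 3)}
    {CB δB : ℝ} (hB : LocStencil₂ vh₂S CB δB) (hδB : 0 < δB) (ε : ℝ) (hε : |ε| ≤ 1) {C₂ C₁ CL₁ CL₂ δ : ℝ} (hδ : 0 < δ)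
    (h₂ : ∀ l, LocStencil₂ (fun (κ : Fin (3 + 1)) (u : Fin (3 + 1) → ℤ) (_ : Fin (3 + 1)) (p : Fin (3 + 1) → ℤ) =>
      divV (fun κ₁ u₁ => (((1 : ℝ) / 2) • (unitS₂ (sfStep Lc l) (smStep 3 Lc l) (T2RecAt 3 Lc (toSite r) cE cVH cΛ cE₂ cB Tc vh₂S (mixFFAt (toSite r) Lc) l)
        + ε • fun κ u κ' u' => sgnK (trK ((unitS₂ (sfStep Lc l) (smStep 3 Lc l) (T2RecAt 3 Lc (toSite r) cE cVH cΛ cE₂ cB Tc vh₂S (mixFFAt (toSite r) Lc) l))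
          κ u κ' u')))) κ u κ₁ u₁) p) C₂ δ)
    (h₁ : ∀ l, LocStencil₂ (fun (_ : Fin (3 + 1)) (p : Fin (3 + 1) → ℤ) (κ' : Fin (3 + 1)) (u' : Fin (3 + 1) → ℤ) =>
      divV (fun κ₁ u₁ => (((1 : ℝ) / 2) • (unitS₂ (sfStep Lc l) (smStep 3 Lc l) (T2RecAt 3 Lc (toSite r) cE cVH cΛ cE₂ cB Tc vh₂S (mixFFAt (toSite r) Lc) l)
        + ε • fun κ u κ' u' => sgnK (trK ((unitS₂ (sfStep Lc l) (smStep 3 Lc l) (T2RecAt 3 Lc (toSite r) cE cVH cΛ cE₂ cB Tc vh₂S (mixFFAt (toSite r) Lc) l))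
          κ u κ' u')))) κ₁ u₁ κ' u') p) C₁ δ)
    (hL₁ : ∀ l, LocStencil₂ (fun κ u κ' u' => fun (p z : Fin (3 + 1) → ℤ) (_ : Fib 3) (b : Fib 3) =>
      ∑ β : Fin (3 + 1), ((((1 : ℝ) / 2) • (unitS₂ (sfStep Lc l) (smStep 3 Lc l) (T2RecAt 3 Lc (toSite r) cE cVH cΛ cE₂ cB Tc vh₂S (mixFFAt (toSite r) Lc) l)
        + ε • fun κ u κ' u' => sgnK (trK ((unitS₂ (sfStep Lc l) (smStep 3 Lc l) (T2RecAt 3 Lc (toSite r) cE cVH cΛ cE₂ cB Tc vh₂S (mixFFAt (toSite r) Lc) l))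
          κ u κ' u')))) κ u κ' u' p z (Sum.inl β) b
        - (((1 : ℝ) / 2) • (unitS₂ (sfStep Lc l) (smStep 3 Lc l) (T2RecAt 3 Lc (toSite r) cE cVH cΛ cE₂ cB Tc vh₂S (mixFFAt (toSite r) Lc) l)
        + ε • fun κ u κ' u' => sgnK (trK ((unitS₂ (sfStep Lc l) (smStep 3 Lc l) (T2RecAt 3 Lc (toSite r) cE cVH cΛ cE₂ cB Tc vh₂S (mixFFAt (toSite r) Lc) l))
          κ u κ' u')))) κ u κ' u' (p - unitVec β) z (Sum.inl β) b)) CL₁ δ)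
    (hL₂ : ∀ l, LocStencil₂ (fun κ u κ' u' => fun (x p : Fin (3 + 1) → ℤ) (a : Fib 3) (_ : Fib 3) =>
      ∑ β : Fin (3 + 1), ((((1 : ℝ) / 2) • (unitS₂ (sfStep Lc l) (smStep 3 Lc l) (T2RecAt 3 Lc (toSite r) cE cVH cΛ cE₂ cB Tc vh₂S (mixFFAt (toSite r) Lc) l)
        + ε • fun κ u κ' u' => sgnK (trK ((unitS₂ (sfStep Lc l) (smStep 3 Lc l) (T2RecAt 3 Lc (toSite r) cE cVH cΛ cE₂ cB Tc vh₂S (mixFFAt (toSite r) Lc) l))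
          κ u κ' u')))) κ u κ' u' x p a (Sum.inl β)
        - (((1 : ℝ) / 2) • (unitS₂ (sfStep Lc l) (smStep 3 Lc l) (T2RecAt 3 Lc (toSite r) cE cVH cΛ cE₂ cB Tc vh₂S (mixFFAt (toSite r) Lc) l)
        + ε • fun κ u κ' u' => sgnK (trK ((unitS₂ (sfStep Lc l) (smStep 3 Lc l) (T2RecAt 3 Lc (toSite r) cE cVH cΛ cE₂ cB Tc vh₂S (mixFFAt (toSite r) Lc) l))
          κ u κ' u')))) κ u κ' u' x (p - unitVec β) a (Sum.inl β))) CL₂ δ) :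
    ∃ Ccl δcl : ℝ, 0 < δcl ∧ ∀ l, LocStencil₂
      (lin4 (cE₂ * (Lc : ℝ) ^ (2 * (3 + 1))) (unitK (sfStep Lc l) (smStep 3 Lc l) (coDressKBmAt (toSite r) Lc (KInvStep (d := 3) Lc l))) Lc (((1 : ℝ) / 2) •
            (unitS₂ (sfStep Lc l) (smStep 3 Lc l) (T2RecAt 3 Lc (toSite r) cE cVH cΛ cE₂ cB Tc vh₂S (mixFFAt (toSite r) Lc) l) + ε • fun κ u κ' u' => sgnK (trK
            ((unitS₂ (sfStep Lc l) (smStep 3 Lc l) (T2RecAt 3 Lc (toSite r) cE cVH cΛ cE₂ cB Tc vh₂S (mixFFAt (toSite r) Lc) l)) κ u κ' u')))) -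
            lin4 (cE₂ * (Lc : ℝ) ^ (2 * (3 + 1))) (unitK (sfStep Lc l) (smStep 3 Lc l) (KInvStep (d := 3) Lc l)) Lc (((1 : ℝ) / 2) • (unitS₂ (sfStep Lc l)
                  (smStep 3 Lc l) (T2RecAt 3 Lc (toSite r) cE cVH cΛ cE₂ cB Tc vh₂S (mixFFAt (toSite r) Lc) l) + ε • fun κ u κ' u' => sgnK (trK ((unitS₂
                  (sfStep Lc l) (smStep 3 Lc l) (T2RecAt 3 Lc (toSite r) cE cVH cΛ cE₂ cB Tc vh₂S (mixFFAt (toSite r) Lc) l)) κ u κ' u'))))) Ccl δcl := by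
  obtain ⟨CK, δK, cK, θK, hδK, -, -, hK, -⟩ := convCKWall_holds (Lc := Lc) hLc
  have hLc1 : 1 ≤ Lc := le_trans (by norm_num) hLc
  -- every `ε`-member has SOME `LocStencil₂` shape (leaf-06's member shape ⨾ the OWNER's `ε`-half)
  have hZ : ∀ l, ∃ CZ δZ : ℝ, 0 < δZ ∧ LocStencil₂ (((1 : ℝ) / 2) • (unitS₂ (sfStep Lc l) (smStep 3 Lc l) (T2RecAt 3 Lc (toSite r) cE cVH cΛ cE₂ cB Tc vh₂S
      (mixFFAt (toSite r) Lc) l) + ε • fun κ u κ' u' => sgnK (trK ((unitS₂ (sfStep Lc l) (smStep 3 Lc l) (T2RecAt 3 Lc (toSite r) cE cVH cΛ cE₂ cB Tc vh₂S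
      (mixFFAt (toSite r) Lc) l)) κ u κ' u')))) CZ δZ := by
    intro l
    obtain ⟨CT, δT, hδT, hT⟩ := shape_member (d := 3) hLc1 hr cE cVH cΛ cE₂ cB Tc ⟨CB, δB, hδB, hB⟩ l
    exact ⟨CT, δT, hδT, locStencil₂_halfTable hT hε⟩
  exact ⟨_, min δK δ / 128, by positivity,
    cell_rows_of_divergence_rows (d := 3) hr (cE₂ * (Lc : ℝ) ^ (2 * (3 + 1)))
      (fun l => ((1 : ℝ) / 2) • (unitS₂ (sfStep Lc l) (smStep 3 Lc l) (T2RecAt 3 Lc (toSite r) cE cVH cΛ cE₂ cB Tc vh₂S (mixFFAt (toSite r) Lc) l)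
        + ε • fun κ u κ' u' => sgnK (trK ((unitS₂ (sfStep Lc l) (smStep 3 Lc l) (T2RecAt 3 Lc (toSite r) cE cVH cΛ cE₂ cB Tc vh₂S (mixFFAt (toSite r) Lc) l))
          κ u κ' u'))))
      hK hδK hδ hZ h₂ h₁ hL₁ hL₂⟩

end Three

end Summit.QuantumFields.BalabanUV.Beta.GAN24.HalfMemberCellOfDivergences

end
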